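import Mathlib
import Summits.NavierStokesRegularity.NavierStokesRegularity.Theorems.ThreadingFluxHorizonTowerQuadraticGeneratorBrackets
import Summits.NavierStokesRegularity.NavierStokesRegularity.Theorems.ThreadingFluxLoopLawSameDegreeBracketRigidity
import HarnessLib

/-!
# Crux `PoloidalLiouville` (stmt-NavierStokesRegularity-1222), crux idea «horizon-threading-tower» (ns-idea-15):
# THE QUADRATIC GENERATOR, IV — eigenvectors: brackets with `L` at the principal axes, linear forms, and the UNIAXIAL LEMMA

Support file (`--supports stmt-NavierStokesRegularity-1222`, helper; cell `ns-wall-extremal`, width hand ns-wall-eng-3 g5; 0 kit), toward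
THM E «the finite tower `{2, 4, 6}` is coaxially zonal at order one».  Real coefficients.

* `genMat` — the real traceless symmetric matrix `Q = [[a,d,e],[d,b,f],[e,f,−a−b]]` of the generator `L = xᵀQx` (`genL`); it is
  Hermitian, so Mathlib's `Matrix.IsHermitian.eigenvectorBasis` gives principal axes `b₀, b₁, b₂` with eigenvalues `λ₀, λ₁, λ₂`;
  `gradient_evalE_genL`: `∇L(y) = 2 Q y`.
* ★ `evalE_detP_genL_eigenvector`: for EVERY polynomial `P`, the loop bracket `{P, L} = det(x, ∇P, ∇L)` VANISHES at the principal axes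
  (`∇L(b_k) = 2λ_k b_k` is parallel to `b_k`).
* `eq_zero_of_isHomogeneous_one_of_eval_eigenvectorBasis`: a linear form vanishing at the three principal axes is zero.
* ★★ THE UNIAXIAL LEMMA `exists_axis_of_genM_eq`: if `|Qx|² = β · xᵀQx + γ · |x|²` as polynomials (i.e. `Q² = βQ + γI`: at most two
  distinct eigenvalues), then `L` is infinitesimally zonal about a real axis `n ≠ 0`: `detP ⟪n,x⟫ L = 0` (two of the three eigenvalues
  coincide; the third axis is `n`; `Q = μI + (λ − μ) n nᵀ`).

HONEST LABEL: linear algebra about one crux idea's typed objects; no Prop of the sketch is closed here; `HorizonTowerZonality` (general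
towers), `PoloidalLiouville` (1222) OPEN; NS regularity NOT proved.  [folklore]
-/

-- the summit and its single sub-problem share the name (CONVENTIONS §1)
set_option linter.dupNamespace false

noncomputable section

open MvPolynomial
open scoped RealInnerProductSpace
open Literature.Analysis.FluidPDE (cross)
open Literature.Geometry.DiscreteGeometry (inner_fin3 norm_sq_fin3)

namespace Summit.NavierStokesRegularity.NavierStokesRegularity.Theorems.PoloidalLiouville.HorizonTower.Zonal

variable (a b d e f : ℝ)

/-! ### The matrix of the generator -/

/-- The real traceless symmetric matrix `Q = [[a,d,e],[d,b,f],[e,f,−a−b]]` of the generator. -/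
def genMat : Matrix (Fin 3) (Fin 3) ℝ := !![a, d, e; d, b, f; e, f, -(a + b)]

/-- `Q` is symmetric (Hermitian over `ℝ`). [folklore] -/
theorem genMat_isHermitian : (genMat a b d e f).IsHermitian :=
  Matrix.IsHermitian.ext fun i j => by fin_cases i <;> fin_cases j <;> simp [genMat]

/-- `tr Q = 0`. [folklore] -/
theorem trace_genMat : (genMat a b d e f).trace = 0 := by
  rw [Matrix.trace_fin_three]; simp [genMat]

/-- The components of `Qv`. [folklore] -/
theorem genMat_mulVec (v : Fin 3 → ℝ) :
    (genMat a b d e f).mulVec v 0 = a * v 0 + d * v 1 + e * v 2 ∧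
      (genMat a b d e f).mulVec v 1 = d * v 0 + b * v 1 + f * v 2 ∧
      (genMat a b d e f).mulVec v 2 = e * v 0 + f * v 1 - (a + b) * v 2 := by
  simp [genMat, Matrix.mulVec, dotProduct, Fin.sum_univ_three]; ring

/-- `L(y) = ⟪y, Qy⟫` in coordinates. [folklore] -/
theorem evalE_genL (y : E3) : evalE (genL a b d e f) y
    = y 0 * (genMat a b d e f).mulVec (fun i => y i) 0 + y 1 * (genMat a b d e f).mulVec (fun i => y i) 1
      + y 2 * (genMat a b d e f).mulVec (fun i => y i) 2 := by
  obtain ⟨h0, h1, h2⟩ := genMat_mulVec a b d e f (fun i => y i)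
  rw [h0, h1, h2]
  simp [genL, genQ0, genQ1, genQ2, evalE]

/-- `M(y) = |Qy|²` in coordinates. [folklore] -/
theorem evalE_genM (y : E3) : evalE (genM a b d e f) y
    = (genMat a b d e f).mulVec (fun i => y i) 0 ^ 2 + (genMat a b d e f).mulVec (fun i => y i) 1 ^ 2
      + (genMat a b d e f).mulVec (fun i => y i) 2 ^ 2 := by
  obtain ⟨h0, h1, h2⟩ := genMat_mulVec a b d e f (fun i => y i)
  rw [h0, h1, h2]
  simp [genM, genQ0, genQ1, genQ2, evalE]

/-- `ρ(y) = ‖y‖²`. [folklore] -/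
theorem evalE_normSq (y : E3) : evalE normSq y = ‖y‖ ^ 2 := by
  rw [norm_sq_fin3]; simp [normSq, evalE]

/-- ★ `∇L(y) = 2Qy`, componentwise. [folklore] -/
theorem gradient_evalE_genL_apply (y : E3) (j : Fin 3) :
    gradient (evalE (genL a b d e f)) y j = 2 * (genMat a b d e f).mulVec (fun i => y i) j := by
  obtain ⟨h0, h1, h2⟩ := genMat_mulVec a b d e f (fun i => y i)
  rw [gradient_evalE_apply]
  fin_cases j
  · simp only [Fin.zero_eta, pderiv_zero_genL, h0]; simp [genQ0, evalE]
  · simp only [Fin.mk_one, pderiv_one_genL, h1]; simp [genQ1, evalE]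
  · simp only [Fin.reduceFinMk, pderiv_two_genL, h2]; simp [genQ2, evalE]

/-- `∇L(v) = 2μ v` at an eigenvector `Qv = μv`. [folklore] -/
theorem gradient_evalE_genL_of_eigen {v : E3} {μ : ℝ} (hv : (genMat a b d e f).mulVec (fun i => v i) = μ • (fun i => v i)) :
    gradient (evalE (genL a b d e f)) v = (2 * μ) • v := by
  ext j
  rw [gradient_evalE_genL_apply, congrFun hv j]
  simp [mul_assoc]

/-! ### Brackets with the generator vanish at the principal axes -/

/-- `⟪v, g × (c v)⟫ = 0`. [folklore] -/
theorem inner_cross_smul_self (v g : E3) (c : ℝ) : ⟪v, cross g (c • v)⟫ = 0 := by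
  rw [inner_fin3]
  obtain ⟨c0, c1, c2⟩ := cross_fin3 g (c • v)
  rw [c0, c1, c2]
  simp only [PiLp.smul_apply, smul_eq_mul]
  ring

/-- ★ For every polynomial `P`, `{P, L}` vanishes at an eigenvector of `Q`. [folklore] -/
theorem evalE_detP_genL_of_eigen (P : RPoly) {v : E3} {μ : ℝ}
    (hv : (genMat a b d e f).mulVec (fun i => v i) = μ • (fun i => v i)) : evalE (detP P (genL a b d e f)) v = 0 := by
  rw [← LoopLaw.loopBracket_evalE, gradient_evalE_genL_of_eigen a b d e f hv]
  exact inner_cross_smul_self v _ _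

/-- ★ For every polynomial `P`, `{L, P}` vanishes at an eigenvector of `Q`. [folklore] -/
theorem evalE_detP_genL_left_of_eigen (P : RPoly) {v : E3} {μ : ℝ}
    (hv : (genMat a b d e f).mulVec (fun i => v i) = μ • (fun i => v i)) : evalE (detP (genL a b d e f) P) v = 0 := by
  rw [Zonal.detP_antisymm, evalE, map_neg, ← evalE, evalE_detP_genL_of_eigen a b d e f P hv, neg_zero]

/-- The eigenvector equation for the `k`-th principal axis, in the form used above. [folklore] -/
theorem genMat_mulVec_eigenvectorBasis (k : Fin 3) :
    (genMat a b d e f).mulVec (fun i => (genMat_isHermitian a b d e f).eigenvectorBasis k i)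
      = (genMat_isHermitian a b d e f).eigenvalues k • (fun i => (genMat_isHermitian a b d e f).eigenvectorBasis k i) :=
  (genMat_isHermitian a b d e f).mulVec_eigenvectorBasis k

/-! ### Linear forms -/

/-- A homogeneous polynomial of degree one is the linear form of its three first partial derivatives (Euler). [folklore] -/
theorem eq_lin_of_isHomogeneous_one {c : RPoly} (hc : c.IsHomogeneous 1) :
    ∃ w : Fin 3 → ℝ, c = C (w 0) * X 0 + C (w 1) * X 1 + C (w 2) * X 2 := by
  have hconst : ∀ i : Fin 3, pderiv i c = C (coeff 0 (pderiv i c)) := fun i => by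
    have h0 : (pderiv i c).IsHomogeneous 0 := by simpa using hc.pderiv (i := i)
    rw [← totalDegree_eq_zero_iff_eq_C, totalDegree_zero_iff_isHomogeneous]
    exact h0
  refine ⟨fun i => coeff 0 (pderiv i c), ?_⟩
  have heuler := hc.sum_X_mul_pderiv
  rw [Fin.sum_univ_three, one_smul, hconst 0, hconst 1, hconst 2] at heuler
  exact heuler.symm.trans (by ring)

/-- A linear form is an inner product. [folklore] -/
theorem evalE_lin (w : Fin 3 → ℝ) (y : E3) :
    evalE (C (w 0) * X 0 + C (w 1) * X 1 + C (w 2) * X 2) y = ⟪WithLp.toLp 2 w, y⟫ := by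
  rw [inner_fin3]; simp [evalE]

/-- ★ A homogeneous polynomial of degree one vanishing at the three principal axes is zero. [folklore] -/
theorem eq_zero_of_isHomogeneous_one_of_eval_eigenvectorBasis {c : RPoly} (hc : c.IsHomogeneous 1)
    (h : ∀ k : Fin 3, evalE c ((genMat_isHermitian a b d e f).eigenvectorBasis k) = 0) : c = 0 := by
  set bv := (genMat_isHermitian a b d e f).eigenvectorBasis with hbv
  obtain ⟨w, hw⟩ := eq_lin_of_isHomogeneous_one hc
  set wv : E3 := WithLp.toLp 2 w with hwv
  have hperp : ∀ k, ⟪bv k, wv⟫ = 0 := fun k => by rw [real_inner_comm, ← evalE_lin, ← hw]; exact h k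
  have hw0 : wv = 0 := by
    rw [← bv.sum_repr' wv]
    simp [hperp]
  have hwi : ∀ i, w i = 0 := fun i => by
    have := congrArg (fun v : E3 => v i) hw0
    simpa [hwv] using this
  rw [hw, hwi 0, hwi 1, hwi 2]
  simp

/-! ### The uniaxial lemma -/

/-- Entries of `Q` from the spectral data: `Q_{ij} = Σ_m λ_m b_m(i) b_m(j)`. [folklore] -/
theorem genMat_apply_eq_sum (i j : Fin 3) :
    genMat a b d e f i j = ∑ m : Fin 3, (genMat_isHermitian a b d e f).eigenvalues m
      * (genMat_isHermitian a b d e f).eigenvectorBasis m i * (genMat_isHermitian a b d e f).eigenvectorBasis m j := by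
  set hQ := genMat_isHermitian a b d e f with hhQ
  set U : Matrix (Fin 3) (Fin 3) ℝ := (hQ.eigenvectorUnitary : Matrix (Fin 3) (Fin 3) ℝ) with hU
  have hUU : U * star U = 1 := by rw [hU]; exact Unitary.coe_mul_star_self _
  have hAU : ∀ i l : Fin 3, (genMat a b d e f * U) i l = hQ.eigenvalues l * hQ.eigenvectorBasis l i := by
    intro i l
    have h1 := congrFun (hQ.mulVec_eigenvectorBasis l) i
    simp only [Matrix.mulVec, dotProduct, Pi.smul_apply, smul_eq_mul] at h1
    rw [Matrix.mul_apply]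
    simp only [hU, Matrix.IsHermitian.eigenvectorUnitary_apply]
    exact h1
  calc genMat a b d e f i j = (genMat a b d e f * (U * star U)) i j := by rw [hUU, mul_one]
    _ = ∑ m : Fin 3, (genMat a b d e f * U) i m * (star U) m j := by rw [← mul_assoc, Matrix.mul_apply]
    _ = _ := by
      refine Finset.sum_congr rfl fun m _ => ?_
      rw [hAU, Matrix.star_apply, hU, Matrix.IsHermitian.eigenvectorUnitary_apply, star_trivial]

/-- Row orthonormality of the spectral data: `Σ_m b_m(i) b_m(j) = δ_{ij}`. [folklore] -/
theorem sum_eigenvectorBasis_mul (i j : Fin 3) :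
    ∑ m : Fin 3, (genMat_isHermitian a b d e f).eigenvectorBasis m i * (genMat_isHermitian a b d e f).eigenvectorBasis m j
      = if i = j then 1 else 0 := by
  set hQ := genMat_isHermitian a b d e f with hhQ
  set U : Matrix (Fin 3) (Fin 3) ℝ := (hQ.eigenvectorUnitary : Matrix (Fin 3) (Fin 3) ℝ) with hU
  have hUU : U * star U = 1 := by rw [hU]; exact Unitary.coe_mul_star_self _
  have h := congrFun (congrFun hUU i) j
  rw [Matrix.mul_apply, Matrix.one_apply] at h
  rw [← h]
  refine Finset.sum_congr rfl fun m _ => ?_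
  rw [Matrix.star_apply, hU, Matrix.IsHermitian.eigenvectorUnitary_apply, Matrix.IsHermitian.eigenvectorUnitary_apply,
    star_trivial]

/-- The eigenvalues of `Q` sum to zero. [folklore] -/
theorem sum_eigenvalues_genMat :
    (genMat_isHermitian a b d e f).eigenvalues 0 + (genMat_isHermitian a b d e f).eigenvalues 1
      + (genMat_isHermitian a b d e f).eigenvalues 2 = 0 := by
  have h := (genMat_isHermitian a b d e f).trace_eq_sum_eigenvalues
  rw [trace_genMat, Fin.sum_univ_three] at h
  simpa using h.symm

/-- The principal axes are unit vectors, in coordinates. [folklore] -/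
theorem sum_sq_eigenvectorBasis (k : Fin 3) :
    (genMat_isHermitian a b d e f).eigenvectorBasis k 0 ^ 2 + (genMat_isHermitian a b d e f).eigenvectorBasis k 1 ^ 2
      + (genMat_isHermitian a b d e f).eigenvectorBasis k 2 ^ 2 = 1 := by
  rw [← norm_sq_fin3, (genMat_isHermitian a b d e f).eigenvectorBasis.orthonormal.1 k, one_pow]

/-- If `|Qx|² = β xᵀQx + γ|x|²` then every eigenvalue satisfies `λ² = βλ + γ`. [folklore] -/
theorem eigenvalues_sq_of_genM_eq {β γ : ℝ} (h : genM a b d e f = C β * genL a b d e f + C γ * normSq) (k : Fin 3) :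
    (genMat_isHermitian a b d e f).eigenvalues k ^ 2
      = β * (genMat_isHermitian a b d e f).eigenvalues k + γ := by
  set hQ := genMat_isHermitian a b d e f with hhQ
  set v : E3 := hQ.eigenvectorBasis k with hv
  have hev := congrFun (hQ.mulVec_eigenvectorBasis k)
  have hval := congrArg (fun p => evalE p v) h
  simp only [evalE_mul, evalE_add, evalE_C] at hval
  rw [evalE_genM, evalE_genL, evalE_normSq] at hval
  have e0 := hev 0; have e1 := hev 1; have e2 := hev 2
  simp only [Pi.smul_apply, smul_eq_mul] at e0 e1 e2
  rw [show (fun i => v i) = ⇑(hQ.eigenvectorBasis k) from rfl, e0, e1, e2, norm_sq_fin3] at hval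
  have hn := sum_sq_eigenvectorBasis a b d e f k
  rw [← hv] at hn
  have : hQ.eigenvalues k ^ 2 * (v 0 ^ 2 + v 1 ^ 2 + v 2 ^ 2)
      = β * (hQ.eigenvalues k * (v 0 ^ 2 + v 1 ^ 2 + v 2 ^ 2)) + γ * (v 0 ^ 2 + v 1 ^ 2 + v 2 ^ 2) := by
    linear_combination hval
  rw [hn] at this
  linarith [this]

/-- `det(x, n, μx + ν⟨n,x⟩n) = 0`: the generator of `Q = μI + ν n nᵀ` is infinitesimally zonal about `n` (polynomial identity, with the
trace relation absorbed). [folklore] -/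
theorem detP_lin_genL_of_entries {μ ν : ℝ} {n : Fin 3 → ℝ} (hrel : 3 * μ + ν * (n 0 ^ 2 + n 1 ^ 2 + n 2 ^ 2) = 0)
    (ha : a = μ + ν * n 0 ^ 2) (hb : b = μ + ν * n 1 ^ 2) (hd : d = ν * (n 0 * n 1)) (he : e = ν * (n 0 * n 2))
    (hf : f = ν * (n 1 * n 2)) :
    detP (C (n 0) * X 0 + C (n 1) * X 1 + C (n 2) * X 2) (genL a b d e f) = 0 := by
  have hrel' : (3 : RPoly) * C μ + C ν * (C (n 0) ^ 2 + C (n 1) ^ 2 + C (n 2) ^ 2) = 0 := by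
    have := congrArg (C : ℝ → RPoly) hrel
    simpa [map_add, map_mul, map_pow, map_ofNat] using this
  rw [detP_lin, pderiv_zero_genL, pderiv_one_genL, pderiv_two_genL]
  simp only [genQ0, genQ1, genQ2, ha, hb, hd, he, hf, map_add, map_mul, map_pow, map_ofNat]
  linear_combination (2 * X 2 * (X 1 * C (n 0) - X 0 * C (n 1))) * hrel'

/-- ★★ **THE UNIAXIAL LEMMA.**  If `|Qx|² = β · xᵀQx + γ · |x|²` as polynomials (`Q² = βQ + γI`), then the generator `L = xᵀQx` is
infinitesimally zonal about some real axis `n ≠ 0`: `detP ⟪n,x⟫ L = 0`. [folklore] -/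
theorem exists_axis_of_genM_eq {β γ : ℝ} (h : genM a b d e f = C β * genL a b d e f + C γ * normSq) :
    ∃ n : Fin 3 → ℝ, n ≠ 0 ∧ detP (C (n 0) * X 0 + C (n 1) * X 1 + C (n 2) * X 2) (genL a b d e f) = 0 := by
  set ev := (genMat_isHermitian a b d e f).eigenvalues with hev
  set bv := (genMat_isHermitian a b d e f).eigenvectorBasis with hbv
  have hsq : ∀ k, ev k ^ 2 = β * ev k + γ := eigenvalues_sq_of_genM_eq a b d e f h
  -- one axis `k` whose two companions share an eigenvalue `μ`
  obtain ⟨k, μ, hμ⟩ : ∃ (k : Fin 3) (μ : ℝ), ∀ m : Fin 3, m ≠ k → ev m = μ := by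
    by_cases h01 : ev 0 = ev 1
    · exact ⟨2, ev 0, fun m hm => by fin_cases m <;> simp_all⟩
    · have hβ : ev 0 + ev 1 = β := by
        have h0 := hsq 0; have h1 := hsq 1
        have : (ev 0 - ev 1) * (ev 0 + ev 1 - β) = 0 := by linear_combination h0 - h1
        rcases mul_eq_zero.mp this with h2 | h2
        · exact absurd (sub_eq_zero.mp h2) h01
        · linarith
      have hγ : ev 0 * ev 1 = -γ := by have h0 := hsq 0; rw [← hβ] at h0; linear_combination -h0
      have h2 : (ev 2 - ev 0) * (ev 2 - ev 1) = 0 := by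
        have := hsq 2; rw [← hβ] at this; linear_combination this + hγ
      rcases mul_eq_zero.mp h2 with h3 | h3
      · exact ⟨1, ev 0, fun m hm => by fin_cases m <;> simp_all [sub_eq_zero]⟩
      · exact ⟨0, ev 1, fun m hm => by fin_cases m <;> simp_all [sub_eq_zero]⟩
  set n : Fin 3 → ℝ := fun i => bv k i with hn
  set ν : ℝ := ev k - μ with hν
  -- the single surviving index in sums over the spectral data
  have hsingle : ∀ g : Fin 3 → ℝ, ∑ m : Fin 3, (ev m - μ) * g m = (ev k - μ) * g k := fun g =>
    Finset.sum_eq_single k (fun m _ hm => by rw [hμ m hm, sub_self, zero_mul]) (fun hk => absurd (Finset.mem_univ k) hk)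
  -- entries of `Q`
  have hentry : ∀ i j : Fin 3, genMat a b d e f i j = μ * (if i = j then 1 else 0) + ν * (n i * n j) := by
    intro i j
    rw [genMat_apply_eq_sum, ← sum_eigenvectorBasis_mul a b d e f i j, Finset.mul_sum, ← hev, ← hbv]
    have hsplit : ∀ m : Fin 3, ev m * bv m i * bv m j = μ * (bv m i * bv m j) + (ev m - μ) * (bv m i * bv m j) := by
      intro m; ring
    rw [Finset.sum_congr rfl fun m _ => hsplit m, Finset.sum_add_distrib, hsingle]
  have hunit : n 0 ^ 2 + n 1 ^ 2 + n 2 ^ 2 = 1 := sum_sq_eigenvectorBasis a b d e f k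
  have htr : 3 * μ + ν * (n 0 ^ 2 + n 1 ^ 2 + n 2 ^ 2) = 0 := by
    have hs := sum_eigenvalues_genMat a b d e f
    rw [← hev, ← Fin.sum_univ_three] at hs
    have hsplit : ∀ m : Fin 3, ev m = μ * 1 + (ev m - μ) * 1 := by intro m; ring
    rw [Finset.sum_congr rfl fun m _ => hsplit m, Finset.sum_add_distrib, hsingle, Fin.sum_univ_three] at hs
    rw [hunit, hν]
    linarith
  have ha : a = μ + ν * n 0 ^ 2 := by have := hentry 0 0; simp [genMat] at this; rw [this]; ring
  have hb : b = μ + ν * n 1 ^ 2 := by have := hentry 1 1; simp [genMat] at this; rw [this]; ring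
  have hd : d = ν * (n 0 * n 1) := by have := hentry 0 1; simp [genMat] at this; rw [this]
  have he : e = ν * (n 0 * n 2) := by have := hentry 0 2; simp [genMat] at this; rw [this]
  have hf : f = ν * (n 1 * n 2) := by have := hentry 1 2; simp [genMat] at this; rw [this]
  refine ⟨n, ?_, detP_lin_genL_of_entries a b d e f htr ha hb hd he hf⟩
  intro h0
  have : n 0 ^ 2 + n 1 ^ 2 + n 2 ^ 2 = 0 := by simp [h0]
  rw [hunit] at this
  exact one_ne_zero this

end Summit.NavierStokesRegularity.NavierStokesRegularity.Theorems.PoloidalLiouville.HorizonTower.Zonal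

end
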